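import Summits.Langlands.Langlands.Theses.QuarterDeficit1951

/-!
# `CensusDeficit1951` (stmt-Langlands-17933) — negative lemma, MULTIPLICITY mode: two window cusp forms for one
# order-5 character refute the certified-census crux (no Hecke operator, no fingerprint, no parity)

Line `Sketch` (lead c1, negation direction) of crux stmt-Langlands-17933
`Summit.Langlands.Langlands.Theses.QuarterDeficit1951.CensusDeficit1951` (D), 2026-08-17.

Format-level truth dichotomy of D (v1 transcripts `Literature.NumberTheory.Automorphic.CertifiedMaassHeckeTraceCensus`,
verdict `certifiesDeficit = wellFormed ∧ (U = 0 ∨ (U = 1 ∧ violation))`, `U` counting ALL cuspidal lines of the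
`χ`-space in the window): D is false iff for some order-5 `χ` EITHER one fingerprinted window line exists (fingerprint
mode — `CensusDeficit1951FalseOfEvenIcosahedralMaassFormAt1951`, `…FalseOfOddWindowCertificate`) OR at least two window
lines exist, counted with multiplicity (this file). Three kernel statements of the second mode:

* `CensusDeficit1951_false_of_TwoWindowMaassCuspFormsAt1951 : TwoWindowMaassCuspFormsAt1951 → ¬ D` — two linearly
  independent weight-0 Maass cusp forms (`IsMaassCuspFormOn 1951 χ uᵢ λᵢ`, `|λᵢ − 1/4| ≤ 1/100`) for one order-5 `χ`
  (crux idea `second-resident-format-kill`, ideator 2; proof adapted from `Cruxes/CensusDeficit1951/Ideator2Sketch.lean`);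
* `not_censusDeficit1951_of_neighbourSighting` — the same with DISTINCT eigenvalues instead of linear independence
  (crux idea `neighbour-multiplicity-kill`, ideator 1; adapted from `Cruxes/CensusDeficit1951/NeighbourMultiplicityKillSketch.lean`):
  the certificate shape of two disjoint Laplace-eigenvalue enclosures;
* `CensusDeficit1951_false_of_certified_two_window_lines` — the census-INTERNAL trigger: one certified transcript
  `c₀` for one order-5 `χ` with `c₀.window ≤ 1/100` and lower count `c₀.lowerCount ≥ 2` refutes D. It rests on the new
  format-soundness lemma `exists_two_inWindow_of_two_le_lowerCount` (`L ≥ 2` forces two distinct window lines), the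
  `L ≥ 2` analogue of the format's `exists_inWindow_of_one_le_lowerCount`; such a `c₀` needs only the `n = 1` trace
  `m_1(h)` and a tail slot, i.e. the PUBLISHED Booker–Lee–Strömbergsson `n = ±1` formula, no Hecke trace formula.

All hypotheses keep their witnesses non-zero / independent (the parent Disproof's `…_false_without_nonzero`).
-/

-- `Summit.<Summit>.<Problem>`: for the single-conjunct summit `Langlands` the duplicate is mandated.
set_option linter.dupNamespace false

namespace Summit.Langlands.Langlands.Theorems.CensusDeficit1951.Negative

open Literature.NumberTheory.Automorphic
open Summit.Langlands.Langlands.Theses.QuarterDeficit1951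

/-- **H₂ — two window Maass cusp forms at conductor 1951 (multiplicity mode).** For some order-5 Dirichlet character
`χ mod 1951` there are two weight-0 Maass cusp forms `u₀, u₁` on `(Γ₀(1951), χ)` in the census' own vocabulary
(`IsMaassCuspFormOn 1951 χ uᵢ λᵢ`: `C²`, `Δuᵢ + λᵢuᵢ = 0`, `χ`-automorphic on `Γ₀(1951)`, cuspidal at every cusp,
bounded) with both eigenvalues in the window `|λᵢ − 1/4| ≤ 1/100`, `u₀ ≢ 0` and `u₁` not a scalar multiple of `u₀`
(equal eigenvalues with multiplicity two allowed). Numerically: the sighted odd `r = 0` icosahedral newform plus one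
generic neighbour with `|r| ≤ 1/10` in either parity (Plancherel load ≈ 0.34 generic lines per character space). A
CONSTRUCTION hypothesis of verdict class computation (two Laplace-only quasimode certificates); not a published theorem,
not provable in-kernel today (no spectral theory of `L²(Γ₀(N)\ℍ, χ)` in Mathlib). -/
def TwoWindowMaassCuspFormsAt1951 : Prop :=
  ∃ χ : DirichletCharacter ℂ 1951, orderOf χ = 5 ∧
    ∃ (u₀ u₁ : UpperHalfPlane → ℂ) (lam₀ lam₁ : ℝ),
      IsMaassCuspFormOn 1951 χ u₀ lam₀ ∧ IsMaassCuspFormOn 1951 χ u₁ lam₁ ∧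
      (∃ z, u₀ z ≠ 0) ∧ (∀ a : ℂ, u₁ ≠ a • u₀) ∧
      |lam₀ - 1 / 4| ≤ 1 / 100 ∧ |lam₁ - 1 / 4| ≤ 1 / 100

/-- **A non-zero cusp form is a line of every joint spectral data.** If `v ≢ 0` is an `IsMaassCuspFormOn N χ v λ`
then any joint spectral data `d` of `(Γ₀(N), χ)` has an index `j` with `λ_j = λ` (completeness clause of
`IsJointSpectralData.exists_eigenbasis`: otherwise `v ∈ span ∅ = ⊥`). [folklore] -/
theorem exists_line_of_cuspForm {N : ℕ} {χ : DirichletCharacter ℂ N} {P : Finset ℕ} {J : Type*}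
    {d : J → MaassHeckeTraceCensus.SpectralLine} (hJ : MaassHeckeTraceCensus.IsJointSpectralData N χ P d)
    {v : UpperHalfPlane → ℂ} {lam : ℝ} (hv : IsMaassCuspFormOn N χ v lam) (hv0 : v ≠ 0) :
    ∃ j, (d j).lam = lam := by
  -- adapted from Cruxes/CensusDeficit1951/NeighbourMultiplicityKillSketch.lean (ideator 1)
  obtain ⟨ub, -, -, -, hspan⟩ := hJ.exists_eigenbasis
  by_contra hno
  push Not at hno
  have hempty : {j | (d j).lam = lam} = (∅ : Set J) :=
    Set.eq_empty_iff_forall_notMem.mpr fun j hj => hno j hj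
  have hmem := hspan v lam hv
  rw [hempty, Set.image_empty, Submodule.span_empty] at hmem
  exact hv0 ((Submodule.mem_bot ℂ).mp hmem)

/-- `(1/100 : ℚ) ≤ c.window` read in `ℝ`. [folklore] -/
theorem window_cast {c : MaassHeckeTraceCensus} (hw : (1 / 100 : ℚ) ≤ c.window) :
    (1 / 100 : ℝ) ≤ (c.window : ℝ) := by
  have h : ((1 / 100 : ℚ) : ℝ) ≤ (c.window : ℝ) := by exact_mod_cast hw
  push_cast at h
  exact h

/-- **`CensusDeficit1951` is false modulo H₂ (second-resident format kill).** Two linearly independent window cusp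
forms for one order-5 `χ` exclude every certified deficit transcript for `χ`: `U = 0` means no window line
(`not_inWindow_of_upperCount_eq_zero`), contradicted by the line of `u₀`; `U = 1` means the window lines form a
subsingleton (`window_subsingleton_of_upperCount_eq_one`), so completeness puts both `u₀` and `u₁` in the span of ONE
basis vector, contradicting independence. No Hecke operator, fingerprint or parity enters. [folklore] -/
theorem CensusDeficit1951_false_of_TwoWindowMaassCuspFormsAt1951 (H : TwoWindowMaassCuspFormsAt1951) :
    ¬ CensusDeficit1951 := by
  -- adapted from Cruxes/CensusDeficit1951/Ideator2Sketch.lean (ideator 2), sorry-free there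
  intro hC
  obtain ⟨χ, hχ, u₀, u₁, lam₀, lam₁, h₀, h₁, hne, hind, hw₀, hw₁⟩ := H
  obtain ⟨c, hw, -, -, hc, hv⟩ := hC χ hχ
  unfold CertifiedMaassHeckeTraceCensus at hc
  obtain ⟨-, hwf, J, d, hJ, hE⟩ := hc
  have hw' := window_cast hw
  have hu0 : u₀ ≠ 0 := by
    obtain ⟨z, hz⟩ := hne
    exact fun h => hz (by simp [h])
  have hu1 : u₁ ≠ 0 := fun h => hind 0 (by rw [h, zero_smul])
  obtain ⟨j₀, hj₀⟩ := exists_line_of_cuspForm hJ h₀ hu0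
  obtain ⟨j₁, hj₁⟩ := exists_line_of_cuspForm hJ h₁ hu1
  have hwin₀ : c.inWindow (d j₀).lam := by
    rw [MaassHeckeTraceCensus.inWindow, hj₀]; exact hw₀.trans hw'
  have hwin₁ : c.inWindow (d j₁).lam := by
    rw [MaassHeckeTraceCensus.inWindow, hj₁]; exact hw₁.trans hw'
  obtain ⟨ub, hform, hHecke, hli, hspan⟩ := hJ.exists_eigenbasis
  unfold MaassHeckeTraceCensus.certifiesDeficit at hv
  simp only [Bool.and_eq_true, Bool.or_eq_true, beq_iff_eq, List.any_eq_true] at hv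
  obtain ⟨-, hU | ⟨hU, -⟩⟩ := hv
  · exact MaassHeckeTraceCensus.not_inWindow_of_upperCount_eq_zero hJ hE hwf hU j₀ hwin₀
  · have huniq : ∀ j, c.inWindow (d j).lam → j = j₀ := fun j hj =>
      MaassHeckeTraceCensus.window_subsingleton_of_upperCount_eq_one hJ hE hwf hU hj hwin₀
    -- every window eigenvalue's lines are the single line `j₀`
    have hS : ∀ lam : ℝ, |lam - 1 / 4| ≤ 1 / 100 → {j | (d j).lam = lam} ⊆ ({j₀} : Set J) := by
      intro lam hlam j hj
      simp only [Set.mem_setOf_eq] at hj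
      have : c.inWindow (d j).lam := by
        rw [MaassHeckeTraceCensus.inWindow, hj]; exact hlam.trans hw'
      exact Set.mem_singleton_iff.mpr (huniq j this)
    have hmem : ∀ (v : UpperHalfPlane → ℂ) (lam : ℝ), IsMaassCuspFormOn 1951 χ v lam →
        |lam - 1 / 4| ≤ 1 / 100 → ∃ a : ℂ, a • ub j₀ = v := by
      intro v lam hv hlam
      have h1 := hspan v lam hv
      have h2 : Submodule.span ℂ (ub '' {j | (d j).lam = lam}) ≤ Submodule.span ℂ {ub j₀} := by
        refine Submodule.span_mono ?_
        intro x hx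
        obtain ⟨j, hj, rfl⟩ := hx
        have := hS lam hlam hj
        rw [Set.mem_singleton_iff] at this
        simp [this]
      exact Submodule.mem_span_singleton.mp (h2 h1)
    obtain ⟨a, ha⟩ := hmem u₀ lam₀ h₀ hw₀
    obtain ⟨b, hb⟩ := hmem u₁ lam₁ h₁ hw₁
    have ha0 : a ≠ 0 := by
      rintro rfl
      exact hu0 (by rw [← ha, zero_smul])
    refine hind (b / a) ?_
    rw [← ha, ← hb, smul_smul, div_mul_cancel₀ b ha0]

/-- **Neighbour sighting refutes the crux** (multiplicity mode, distinct-eigenvalue shape). Two non-zero weight-0 Maass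
cusp forms on `(Γ₀(1951), χ)`, `χ` of order 5, with DIFFERENT Laplace eigenvalues both in `|λ − 1/4| ≤ 1/100` (the
shape two disjoint certified eigenvalue enclosures deliver) exclude every certified deficit transcript for `χ`: the two
eigenvalues are two distinct window lines of its spectral data, against `U ≤ 1`. [folklore] -/
theorem not_censusDeficit1951_of_neighbourSighting
    (h : ∃ χ : DirichletCharacter ℂ 1951, orderOf χ = 5 ∧
      ∃ (u₁ u₂ : UpperHalfPlane → ℂ) (l₁ l₂ : ℝ),
        IsMaassCuspFormOn 1951 χ u₁ l₁ ∧ IsMaassCuspFormOn 1951 χ u₂ l₂ ∧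
        (∃ z, u₁ z ≠ 0) ∧ (∃ z, u₂ z ≠ 0) ∧ l₁ ≠ l₂ ∧
        |l₁ - 1 / 4| ≤ 1 / 100 ∧ |l₂ - 1 / 4| ≤ 1 / 100) :
    ¬ CensusDeficit1951 := by
  -- adapted from Cruxes/CensusDeficit1951/NeighbourMultiplicityKillSketch.lean (ideator 1), sorry-free there
  rintro hD
  obtain ⟨χ, hχ, u₁, u₂, l₁, l₂, hu₁, hu₂, hne₁, hne₂, hl, hw₁, hw₂⟩ := h
  obtain ⟨c, hwin, -, -, hc, hv⟩ := hD χ hχ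
  unfold CertifiedMaassHeckeTraceCensus at hc
  obtain ⟨-, hw, J, d, hJ, hE⟩ := hc
  have hne₁' : u₁ ≠ 0 := by
    obtain ⟨z, hz⟩ := hne₁
    exact fun h0 => hz (by simp [h0])
  have hne₂' : u₂ ≠ 0 := by
    obtain ⟨z, hz⟩ := hne₂
    exact fun h0 => hz (by simp [h0])
  obtain ⟨j₁, hj₁⟩ := exists_line_of_cuspForm hJ hu₁ hne₁'
  obtain ⟨j₂, hj₂⟩ := exists_line_of_cuspForm hJ hu₂ hne₂'
  have hjne : j₁ ≠ j₂ := by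
    rintro rfl
    exact hl (hj₁.symm.trans hj₂)
  have hwin' := window_cast hwin
  have hin₁ : c.inWindow (d j₁).lam := by
    rw [MaassHeckeTraceCensus.inWindow, hj₁]; exact hw₁.trans hwin'
  have hin₂ : c.inWindow (d j₂).lam := by
    rw [MaassHeckeTraceCensus.inWindow, hj₂]; exact hw₂.trans hwin'
  unfold MaassHeckeTraceCensus.certifiesDeficit at hv
  simp only [Bool.and_eq_true, Bool.or_eq_true, beq_iff_eq] at hv
  obtain ⟨-, hU | ⟨hU, -⟩⟩ := hv
  · exact MaassHeckeTraceCensus.not_inWindow_of_upperCount_eq_zero hJ hE hw hU j₁ hin₁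
  · exact hjne (MaassHeckeTraceCensus.window_subsingleton_of_upperCount_eq_one hJ hE hw hU hin₁ hin₂)

/-! ## The census-internal trigger: lower count `L ≥ 2` -/

/-- **Soundness of the lower count, `L ≥ 2`: two distinct lines lie in the window.** With a tail slot `(g, B)`,
`L = ⌈(m1lo − B.hi)/hhi⌉₊ ≥ 2` means `m1lo − B.hi > hhi`; the window mass `Σ_window h(r_j) ≥ Σ_j h(r_j) − Σ_j g(r_j)
≥ m1lo − B.hi` (as `h ≤ g` off the window and `g ≥ 0`), while at most one window line would give window mass `≤ hhi`.
The `L ≥ 2` analogue of the format's `exists_inWindow_of_one_le_lowerCount`. [folklore] -/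
theorem exists_two_inWindow_of_two_le_lowerCount {c : MaassHeckeTraceCensus} {N : ℕ} {χ : DirichletCharacter ℂ N}
    {J : Type*} {d : J → MaassHeckeTraceCensus.SpectralLine}
    (hJ : MaassHeckeTraceCensus.IsJointSpectralData N χ c.indices d) (hE : c.EnclosesSpectralData χ d)
    (hw : c.wellFormed = true) (hL : 2 ≤ c.lowerCount) :
    ∃ j j', j ≠ j' ∧ c.inWindow (d j).lam ∧ c.inWindow (d j').lam := by
  classical
  obtain ⟨S, hS, hSlo, -⟩ := MaassHeckeTraceCensus.exists_hasSum_weights hJ hE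
  have hspec := MaassHeckeTraceCensus.wellFormed_spec hw
  have hhi : 0 < c.hhi := hspec.2.1.trans_le hspec.2.2.1
  unfold MaassHeckeTraceCensus.lowerCount at hL
  rcases htail : c.tail with _ | ⟨g, B⟩
  · simp [htail] at hL
  · simp only [htail] at hL
    have hlt1 : (1 : ℚ) < (c.m1lo - B.hi) / c.hhi := by
      have h2 : 1 < ⌈(c.m1lo - B.hi) / c.hhi⌉₊ := hL
      exact_mod_cast Nat.lt_ceil.mp h2
    have hgap : c.hhi < c.m1lo - B.hi := by rwa [lt_div_iff₀ hhi, one_mul] at hlt1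
    have hgapR : (c.hhi : ℝ) < c.m1lo - B.hi := by exact_mod_cast hgap
    obtain ⟨⟨t, ht, htB⟩, hdom⟩ := hE.tail_spec g B htail
    by_contra hno
    push Not at hno
    -- the window index set is a subsingleton; compare `h` with `g` termwise off (at most) one index
    by_cases hex : ∃ j₀, c.inWindow (d j₀).lam
    · obtain ⟨j₀, hj₀⟩ := hex
      have huniq : ∀ j, c.inWindow (d j).lam → j = j₀ := fun j hj => by
        by_contra hne
        exact hno j j₀ hne hj hj₀
      have hsub := hasSum_ite_sub_hasSum hS j₀
      have hB : S - c.maj.eval (d j₀).lam ≤ t := by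
        refine hasSum_le (fun j => ?_) hsub ht
        split_ifs with h
        · exact g.eval_nonneg _
        · exact hdom _ (hJ.lam_pos j) fun hw' => h (huniq j hw')
      have hhj₀ : c.maj.eval (d j₀).lam ≤ c.hhi := (hE.window_bounds _ (hJ.lam_pos j₀) hj₀).2
      linarith [htB.2]
    · push Not at hex
      have hle : S ≤ t := hasSum_le (fun j => hdom _ (hJ.lam_pos j) (hex j)) hS ht
      have hhi' : (0 : ℝ) < c.hhi := by exact_mod_cast hhi
      linarith [htB.2]

/-- In a linearly independent family, `u j'` is not a scalar multiple of `u j` for `j ≠ j'`. [folklore] -/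
theorem ne_smul_of_linearIndependent {J : Type*} {u : J → UpperHalfPlane → ℂ} (hli : LinearIndependent ℂ u)
    {j j' : J} (hne : j ≠ j') (a : ℂ) : u j' ≠ a • u j := by
  classical
  intro h
  have hrel : ∑ i ∈ ({j, j'} : Finset J), (if i = j then a else -1) • u i = 0 := by
    rw [Finset.sum_pair hne]
    simp only [if_true, if_neg hne.symm, h, neg_one_smul, add_neg_cancel]
  have := linearIndependent_iff'.mp hli {j, j'} (fun i => if i = j then a else -1) hrel j'
    (Finset.mem_insert_of_mem (Finset.mem_singleton_self _))
  simp [if_neg hne.symm] at this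

/-- **Census-internal trigger: a certified transcript with `L ≥ 2` for one order-5 character refutes the crux.** If
some order-5 `χ mod 1951` has a certified transcript `c₀` (`CertifiedMaassHeckeTraceCensus 1951 χ c₀`) with
`c₀.window ≤ 1/100` and `2 ≤ c₀.lowerCount`, then `CensusDeficit1951` is false: `c₀`'s joint spectral data has two
distinct window lines (`exists_two_inWindow_of_two_le_lowerCount`), whose eigenbasis vectors are two linearly independent
window cusp forms, i.e. `TwoWindowMaassCuspFormsAt1951`. Such a `c₀` uses only the `n = 1` trace and a tail slot. [folklore] -/
theorem CensusDeficit1951_false_of_certified_two_window_lines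
    (h : ∃ χ : DirichletCharacter ℂ 1951, orderOf χ = 5 ∧ ∃ c₀ : MaassHeckeTraceCensus,
      c₀.window ≤ 1 / 100 ∧ CertifiedMaassHeckeTraceCensus 1951 χ c₀ ∧ 2 ≤ c₀.lowerCount) :
    ¬ CensusDeficit1951 := by
  obtain ⟨χ, hχ, c₀, hw₀, hc₀, hL⟩ := h
  unfold CertifiedMaassHeckeTraceCensus at hc₀
  obtain ⟨-, hwf₀, J₀, d₀, hJ₀, hE₀⟩ := hc₀
  obtain ⟨j, j', hjj', hj, hj'⟩ := exists_two_inWindow_of_two_le_lowerCount hJ₀ hE₀ hwf₀ hL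
  obtain ⟨ub, hform, -, hli, -⟩ := hJ₀.exists_eigenbasis
  have hw₀' : (c₀.window : ℝ) ≤ 1 / 100 := by
    have : ((c₀.window : ℚ) : ℝ) ≤ ((1 / 100 : ℚ) : ℝ) := by exact_mod_cast hw₀
    push_cast at this
    exact this
  refine CensusDeficit1951_false_of_TwoWindowMaassCuspFormsAt1951
    ⟨χ, hχ, ub j, ub j', (d₀ j).lam, (d₀ j').lam, hform j, hform j', ?_,
      ne_smul_of_linearIndependent hli hjj', ?_, ?_⟩
  · by_contra h0
    push Not at h0
    exact hli.ne_zero j (funext h0)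
  · exact le_trans hj hw₀'
  · exact le_trans hj' hw₀'

end Summit.Langlands.Langlands.Theorems.CensusDeficit1951.Negative
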